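import Literature.NumberTheory.NumberFields.EquivariantIwasawaLemmaTotallyRamified
import HarnessLib

/-!
# The equivariant Iwasawa lemma, VIII: hypothesis (c3*) from the INERTIA groups of the base field `L₀`
# (door L6 for `L₀K_n` with `V^{I(𝔮|p)} = 0`, `𝔮` the primes of `L₀` above `p`)

Topic `NumberTheory/NumberFields` (namespace = path, grouping sub-namespace `EquivariantIwasawaLemma`).
THEOREM-ONLY file (no definition, no named fact, no `sorry`), written by the prover seat `bsd-potss-k8t-c4` g25
(cell `bsd-potss`; `--supports` stmt-BirchSwinnertonDyer-19982, the U₀ node of route K8-t′; closes nothing; neither BSD nor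
Conjecture A is proved for any curve here).  Sequel of `EquivariantIwasawaLemmaTotallyRamified.lean` (seat conjA-anchor g16).

The tower theorems there take hypothesis (c3*) in the form «`V^{D_v} = 0` for the decomposition groups `D_v ≤ Γ_k` of the
places `v ∣ p`» (`GreenbergSelmer.decomp`).  For the cell's ISOTYPIC use (`V` a permutation-type module of `Gal(L₀/k)`,
file `ClassGroupRankEqualityCosetKernel.lean`) the natural and weaker input is at the FINITE level `L₀`:

> (c3*-I) for every prime `𝔮` of `L₀` above `p`, no non-zero vector of `V` is fixed by every `τ ∈ Γ_k` whose
> restriction to `L₀` lies in the inertia group `I(𝔮) ≤ Gal(L₀/k)`.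

* `eq_zero_of_forall_stabilizer_smul_of_inertia` — (c3*-I) implies the stabiliser form of (c3*) used by the layer
  lemma: for `F ⊆ k̄` finite Galois over `k` and a prime `𝔓 ∋ p` of `F`, `V^{Stab_Γ(𝔓)} = 0`.  PROOF: choose a prime
  `𝔓̄` of `ℤ̄_k` above `𝔓` and put `𝔮 = 𝔓̄ ∩ L₀ ∋ p`; the absolute inertia group `I_𝔓̄ ≤ Γ_k` restricts ONTO `I(𝔓) ≤ Gal(F/k)`
  and ONTO `I(𝔮) ≤ Gal(L₀/k)` (Serre I §7 Prop. 22 (b), tree `inertia_comap_ringOfIntegers_eq_map_absRestrictNormalHom`), and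
  `I(𝔓) ≤ Stab(𝔓)` (Mathlib `Ideal.inertia_le_stabilizer`); so a vector fixed by `Stab_Γ(𝔓)` is fixed by `I_𝔓̄`, hence by every
  `τ` with `τ|_{L₀} ∈ I(𝔮)` (`τ = τ' · τ₀`, `τ' ∈ I_𝔓̄`, `τ₀|_{L₀} = 1` acting trivially), hence zero.
* `equivariantHom_classGroup_eq_zero_layer_compositum_tower_of_inertia` — DOOR L6 with (c3*-I): `k` a number field, `p` odd,
  `κ` a `ℤ_p`-extension of `k`, `L₀ ⊆ k̄` finite Galois with `p ∤ [L₀ : k]`, a prime of `ℤ̄_k` totally ramified in `K_∞/k`,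
  `V` a `p`-torsion `Γ_k`-module with `Γ_{L₀}` acting trivially, (c2*) `Hom_Γ(Cl(L₀), V) = 0`, (c3*-I) ⟹
  `Hom_Γ(Cl(L₀K_n), V) = 0` for every `n` (verbatim the proof of
  `equivariantHom_classGroup_eq_zero_layer_compositum_tower_of_totallyRamified` with the (c3*) discharge replaced).
* `equivariantHom_classGroup_eq_zero_layer_compositum_tower_of_inertia_rat` — the same for `k = ℚ`, `κ` cyclotomic (the
  totally ramified prime exists: `exists_isMaximal_inertia_sup_kerSubgroup_eq_top_of_isCyclotomic`).

## References

* L. C. Washington, *Introduction to Cyclotomic Fields*, 2nd ed., GTM 83 (1997), §13.1 Prop. 13.2, §13.3 Lemmas 13.14–13.15,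
  Thm. 10.4. [Washington1997]
* J.-P. Serre, *Local Fields*, GTM 67 (1979), Ch. I §7 Prop. 22 (b). [SerreLocalFields1979]
* J. Neukirch, *Algebraic Number Theory* (1999), Ch. I §9 (9.1), Ch. VI (6.9), (7.1), Ch. IV §6. [NeukirchANT1999]
-/

noncomputable section

open scoped Pointwise nonZeroDivisors
open NumberField Field IntermediateField Ideal IsDedekindDomain
open Literature.NumberTheory.GaloisRepresentations
open Literature.NumberTheory.EllipticCurves (ringOfIntegersToIntegralClosure
  coe_ringOfIntegersToIntegralClosure ringOfIntegersToIntegralClosure_comp_algebraMap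
  ringOfIntegersToIntegralClosure_injective ZpExtension)

namespace Literature.NumberTheory.NumberFields

namespace EquivariantIwasawaLemma

section Inertia

variable {k : Type} [Field k]

/-- A prime of `ℤ̄_k` above a given prime of `𝓞 F` (`F ⊆ k̄`): lying over for the integral extension
`𝓞 F → ℤ̄_k`. [folklore] -/
private theorem exists_isPrime_comap_eq' (F : IntermediateField k (AlgebraicClosure k))
    (Q : Ideal (𝓞 F)) [Q.IsPrime] :
    ∃ 𝔓 : Ideal (absIntegers (𝓞 k) k), 𝔓.IsPrime ∧
      𝔓.comap (ringOfIntegersToIntegralClosure (k := k) (Ω := AlgebraicClosure k) F) = Q := by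
  set φ : 𝓞 F →+* absIntegers (𝓞 k) k :=
    ringOfIntegersToIntegralClosure (k := k) (Ω := AlgebraicClosure k) F with hφ
  have hφalg : ∀ x : 𝓞 k, φ (algebraMap (𝓞 k) (𝓞 F) x) =
      algebraMap (𝓞 k) (absIntegers (𝓞 k) k) x := fun x ↦ rfl
  letI : Algebra (𝓞 F) (absIntegers (𝓞 k) k) := φ.toAlgebra
  haveI : IsScalarTower (𝓞 k) (𝓞 F) (absIntegers (𝓞 k) k) :=
    IsScalarTower.of_algebraMap_eq fun x ↦ (hφalg x).symm
  haveI : Algebra.IsIntegral (𝓞 F) (absIntegers (𝓞 k) k) :=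
    ⟨fun x ↦ (Algebra.IsIntegral.isIntegral (R := 𝓞 k) x).tower_top⟩
  obtain ⟨𝔓, -, h𝔓prime, h𝔓Q⟩ := Ideal.exists_ideal_over_prime_of_isIntegral Q
    (⊥ : Ideal (absIntegers (𝓞 k) k))
    (fun x hx ↦ by
      rw [Ideal.mem_comap, Ideal.mem_bot] at hx
      have hx0 : x = 0 :=
        ringOfIntegersToIntegralClosure_injective F (hx.trans (map_zero _).symm)
      rw [hx0]
      exact Q.zero_mem)
  exact ⟨𝔓, h𝔓prime, h𝔓Q⟩


/-- `ℤ̄_k` is integral over `𝓞 F` along `ι_F`. [folklore] -/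
private theorem isIntegral_ringOfIntegersToIntegralClosure' (F : IntermediateField k (AlgebraicClosure k)) :
    (ringOfIntegersToIntegralClosure (k := k) (Ω := AlgebraicClosure k) F).IsIntegral := by
  letI : Algebra (𝓞 F) (integralClosure (𝓞 k) (AlgebraicClosure k)) :=
    (ringOfIntegersToIntegralClosure (k := k) (Ω := AlgebraicClosure k) F).toAlgebra
  haveI : IsScalarTower (𝓞 k) (𝓞 F) (integralClosure (𝓞 k) (AlgebraicClosure k)) :=
    IsScalarTower.of_algebraMap_eq (R := 𝓞 k) (S := 𝓞 F)
      (A := integralClosure (𝓞 k) (AlgebraicClosure k)) fun _ ↦ rfl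
  intro x
  change IsIntegral (𝓞 F) x
  exact (Algebra.IsIntegral.isIntegral (R := 𝓞 k) x).tower_top

/-- `τ|_E = 1` iff `τ ∈ Gal(k̄/E)` (`fixingSubgroup`). [folklore] -/
private theorem absRestrictNormalHom_eq_one_iff_mem_fixingSubgroup₃
    (E : IntermediateField k (AlgebraicClosure k)) [Normal k E] (τ : absoluteGaloisGroup k) :
    absRestrictNormalHom E τ = 1 ↔ absoluteGaloisGroup.toAlgEquiv k τ ∈ E.fixingSubgroup := by
  have hc : ∀ x : E, ((absRestrictNormalHom E τ x : E) : AlgebraicClosure k) =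
      τ • (x : AlgebraicClosure k) := fun x => AlgEquiv.restrictNormalHom_apply E _ x
  rw [IntermediateField.mem_fixingSubgroup_iff]
  constructor
  · intro h x hx
    change τ • x = x
    rw [← hc ⟨x, hx⟩, h, AlgEquiv.one_apply]
  · intro h
    ext x
    rw [hc x, AlgEquiv.one_apply]
    exact h x x.2

/-- `ι_F(p) = p`. [folklore] -/
private theorem ringOfIntegersToIntegralClosure_natCast (F : IntermediateField k (AlgebraicClosure k)) (p : ℕ) :
    ringOfIntegersToIntegralClosure (k := k) (Ω := AlgebraicClosure k) F ((p : ℕ) : 𝓞 F) =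
      ((p : ℕ) : absIntegers (𝓞 k) k) :=
  map_natCast (ringOfIntegersToIntegralClosure (k := k) (Ω := AlgebraicClosure k) F) p

variable [NumberField k]

/-- `g|_{K_m} = 1 ↔ g ∈ κ⁻¹(pᵐℤ_p)` (Krull–Galois for the layer, tree `fixingSubgroup_layer`). [folklore] -/
private theorem absRestrictNormalHom_layer_eq_one_iff₃ {p : ℕ} [Fact p.Prime] (κ : ZpExtension k p)
    (m : ℕ) [Normal k (κ.layer m)] (g : absoluteGaloisGroup k) :
    absRestrictNormalHom (κ.layer m) g = 1 ↔ g ∈ κ.layerSubgroup m := by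
  rw [absRestrictNormalHom_eq_one_iff_mem_fixingSubgroup₃, κ.fixingSubgroup_layer m]
  constructor
  · rintro ⟨g', hg', hgg'⟩
    have : g' = g := (absoluteGaloisGroup.toAlgEquiv k).injective hgg'
    exact this ▸ hg'
  · exact fun h => ⟨g, h, rfl⟩

set_option synthInstance.maxHeartbeats 200000 in
set_option maxHeartbeats 800000 in
/-- **`V^{Stab_Γ(𝔓)} = 0` from (c3*-I) `V^{I(𝔮)} = 0`, `𝔮 ∣ p` the primes of `L₀`.**  `L₀, F ⊆ k̄` finite Galois over the
number field `k`, `𝔓` a prime of `F` containing the rational prime `p`, `V` a `Γ_k`-module on which `Γ_{L₀}` acts trivially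
and such that for every prime `𝔮 ∋ p` of `L₀` no non-zero vector is fixed by all `τ ∈ Γ_k` with `τ|_{L₀} ∈ I(𝔮)`.  Then no
non-zero `w ∈ V` is fixed by `{τ ∈ Γ_k : τ|_F 𝔓 = 𝔓}`.  (With `𝔓̄ ∣ 𝔓` a prime of `ℤ̄_k` and `𝔮 = 𝔓̄ ∩ L₀`: `I_𝔓̄` restricts onto
`I(𝔓) ≤ Stab(𝔓)` and onto `I(𝔮)`, Serre I §7 Prop. 22 (b).) [cite: SerreLocalFields1979, Ch. I §7 Prop. 22(b)]
[cite: NeukirchANT1999, Ch. I §9 (9.1)] -/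
theorem eq_zero_of_forall_stabilizer_smul_of_inertia
    (L₀ F : IntermediateField k (AlgebraicClosure k)) [FiniteDimensional k L₀] [IsGalois k L₀]
    [FiniteDimensional k F] [IsGalois k F]
    (𝔓 : Ideal (𝓞 F)) [𝔓.IsMaximal] {p : ℕ} [hp : Fact p.Prime] (hp𝔓 : ((p : ℕ) : 𝓞 F) ∈ 𝔓)
    {V : Type*} [AddCommGroup V] [DistribMulAction (absoluteGaloisGroup k) V]
    (hV : ∀ τ : absoluteGaloisGroup k, absRestrictNormalHom L₀ τ = 1 → ∀ v : V, τ • v = v)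
    (hDI : ∀ (𝔮 : Ideal (𝓞 L₀)) [𝔮.IsMaximal], ((p : ℕ) : 𝓞 L₀) ∈ 𝔮 →
      ∀ w : V, (∀ τ : absoluteGaloisGroup k,
        absRestrictNormalHom L₀ τ ∈ 𝔮.inertia (L₀ ≃ₐ[k] L₀) → τ • w = w) → w = 0)
    (w : V) (hw : ∀ τ : absoluteGaloisGroup k, absRestrictNormalHom F τ • 𝔓 = 𝔓 → τ • w = w) :
    w = 0 := by
  obtain ⟨𝔓', h𝔓'prime, h𝔓'⟩ := exists_isPrime_comap_eq' F 𝔓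
  haveI := h𝔓'prime
  -- `p ∈ 𝔓̄`
  haveI : NumberField L₀ := NumberField.of_module_finite k L₀
  have hp𝔓' : ringOfIntegersToIntegralClosure (k := k) (Ω := AlgebraicClosure k) F ((p : ℕ) : 𝓞 F) ∈ 𝔓' := by
    have h := hp𝔓
    rw [← h𝔓', Ideal.mem_comap] at h
    exact h
  have e1 : ringOfIntegersToIntegralClosure (k := k) (Ω := AlgebraicClosure k) F ((p : ℕ) : 𝓞 F) =
      ringOfIntegersToIntegralClosure (k := k) (Ω := AlgebraicClosure k) L₀ ((p : ℕ) : 𝓞 L₀) := by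
    rw [ringOfIntegersToIntegralClosure_natCast, ringOfIntegersToIntegralClosure_natCast]
  -- `𝔮 = 𝔓̄ ∩ L₀`, a maximal ideal of `𝓞 L₀` containing `p`
  set 𝔮 : Ideal (𝓞 L₀) :=
    𝔓'.comap (ringOfIntegersToIntegralClosure (k := k) (Ω := AlgebraicClosure k) L₀) with h𝔮def
  have hp𝔮 : ((p : ℕ) : 𝓞 L₀) ∈ 𝔮 := by
    rw [h𝔮def, Ideal.mem_comap]
    exact (congrArg (fun x => x ∈ 𝔓') e1).mp hp𝔓'
  haveI h𝔮prime : 𝔮.IsPrime := Ideal.IsPrime.comap _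
  have h𝔮ne : 𝔮 ≠ ⊥ := fun h => by
    rw [h, Ideal.mem_bot] at hp𝔮
    exact hp.out.ne_zero (by exact_mod_cast hp𝔮)
  haveI : 𝔮.IsMaximal := h𝔮prime.isMaximal h𝔮ne
  -- the absolute inertia group restricts onto `I(𝔓)` and onto `I(𝔮)`
  have hIF : 𝔓.inertia (F ≃ₐ[k] F) = (𝔓'.inertia (absoluteGaloisGroup k)).map (absRestrictNormalHom F) := by
    rw [← h𝔓']
    exact inertia_comap_ringOfIntegers_eq_map_absRestrictNormalHom F 𝔓'
  have hIL : 𝔮.inertia (L₀ ≃ₐ[k] L₀) = (𝔓'.inertia (absoluteGaloisGroup k)).map (absRestrictNormalHom L₀) :=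
    inertia_comap_ringOfIntegers_eq_map_absRestrictNormalHom L₀ 𝔓'
  -- `w` is fixed by `I_𝔓̄` (inertia ≤ stabiliser at level `F`)
  have hIS := Ideal.inertia_le_stabilizer (M := F ≃ₐ[k] F) 𝔓
  have hwI : ∀ τ ∈ 𝔓'.inertia (absoluteGaloisGroup k), τ • w = w := fun τ hτ => by
    refine hw τ ?_
    have h1 : absRestrictNormalHom F τ ∈ 𝔓.inertia (F ≃ₐ[k] F) := by
      rw [hIF]
      exact Subgroup.mem_map_of_mem _ hτ
    exact hIS h1
  -- hence by every `τ` with `τ|_{L₀} ∈ I(𝔮)`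
  refine hDI 𝔮 hp𝔮 w fun τ hτ => ?_
  rw [hIL] at hτ
  obtain ⟨τ', hτ'I, hτ'eq⟩ := Subgroup.mem_map.mp hτ
  have hfix : (τ'⁻¹ * τ) • w = w :=
    hV _ (by rw [map_mul, map_inv, hτ'eq, inv_mul_cancel]) w
  calc τ • w = (τ' * (τ'⁻¹ * τ)) • w := by rw [mul_inv_cancel_left]
    _ = τ' • ((τ'⁻¹ * τ) • w) := mul_smul _ _ _
    _ = τ' • w := by rw [hfix]
    _ = w := hwI τ' hτ'I

set_option maxHeartbeats 1600000 in
set_option synthInstance.maxHeartbeats 200000 in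
/-- **Door L6 with (c3*-I): the equivariant Iwasawa lemma along `L₀K_n` from the inertia groups of `L₀`.**  `k` a number
field, `p` an odd prime, `κ` a `ℤ_p`-extension of `k` with layers `K_n`, `L₀ ⊆ k̄` finite Galois over `k` with `p ∤ [L₀ : k]`, a
maximal ideal `𝔓̄` of `ℤ̄_k` totally ramified in `K_∞/k` (`I_𝔓̄ · Gal(k̄/K_∞) = Γ_k`).  `V` a `p`-torsion `Γ_k`-module on which
`Γ_{L₀}` acts trivially, with (c2*) every additive `Γ_k`-equivariant `Cl(𝓞_{L₀}) → V` zero and (c3*-I) for every prime `𝔮 ∋ p`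
of `L₀`, no non-zero vector fixed by all `τ` with `τ|_{L₀} ∈ I(𝔮)`.  Then for every `n` every additive `Γ_k`-equivariant
`Cl(𝓞_{L₀K_n}) → V` is zero.  (`equivariantHom_classGroup_eq_zero_compositum_tower` with (c3*)ₙ from
`eq_zero_of_forall_stabilizer_smul_of_inertia` — the ramified primes of `L₀K_{n+1}` contain `p`,
`natCast_mem_of_mem_inertia_of_absRestrictNormalHom_layer_ne_one` — and the orbit input from
`exists_orbit_input_of_totallyRamified`.) [cite: Washington1997, §13.1 Prop. 13.2, §13.3 Lemmas 13.14–13.15 and Thm. 10.4 (proof)]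
[cite: SerreLocalFields1979, Ch. I §7 Prop. 22(b)] -/
theorem equivariantHom_classGroup_eq_zero_layer_compositum_tower_of_inertia {p : ℕ} [Fact p.Prime]
    (hp2 : p ≠ 2) (κ : ZpExtension k p)
    (L₀ : IntermediateField k (AlgebraicClosure k)) [FiniteDimensional k L₀] [IsGalois k L₀]
    (hL₀ : ¬ p ∣ Module.finrank k L₀)
    [∀ n, FiniteDimensional k (κ.layer n)] [∀ n, IsGalois k (κ.layer n)]
    [∀ n, NumberField (L₀ ⊔ κ.layer n : IntermediateField k (AlgebraicClosure k))]
    (hram : ∃ 𝔓' : Ideal (absIntegers (𝓞 k) k), 𝔓'.IsMaximal ∧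
      𝔓'.inertia (absoluteGaloisGroup k) ⊔ κ.kerSubgroup = ⊤)
    {V : Type*} [AddCommGroup V] [DistribMulAction (absoluteGaloisGroup k) V]
    (hpV : ∀ v : V, p • v = 0)
    (hV : ∀ τ : absoluteGaloisGroup k, absRestrictNormalHom L₀ τ = 1 → ∀ v : V, τ • v = v)
    (h0 : ∀ μ : Additive (ClassGroup (𝓞 L₀)) →+ V,
      (∀ (τ : absoluteGaloisGroup k) (c : ClassGroup (𝓞 L₀)),
        μ (Additive.ofMul (ClassGroup.mulEquiv
          (AmbiguousClass.intAut (absRestrictNormalHom L₀ τ)) c)) = τ • μ (Additive.ofMul c)) →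
      μ = 0)
    (hDI : ∀ (𝔮 : Ideal (𝓞 L₀)) [𝔮.IsMaximal], ((p : ℕ) : 𝓞 L₀) ∈ 𝔮 →
      ∀ w : V, (∀ τ : absoluteGaloisGroup k,
        absRestrictNormalHom L₀ τ ∈ 𝔮.inertia (L₀ ≃ₐ[k] L₀) → τ • w = w) → w = 0)
    (n : ℕ)
    (f : Additive (ClassGroup (𝓞 (L₀ ⊔ κ.layer n : IntermediateField k (AlgebraicClosure k)))) →+ V)
    (hf : ∀ (τ : absoluteGaloisGroup k)
        (c : ClassGroup (𝓞 (L₀ ⊔ κ.layer n : IntermediateField k (AlgebraicClosure k)))),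
      f (Additive.ofMul (ClassGroup.mulEquiv (AmbiguousClass.intAut
        (absRestrictNormalHom (L₀ ⊔ κ.layer n : IntermediateField k (AlgebraicClosure k)) τ)) c)) =
        τ • f (Additive.ofMul c)) :
    f = 0 := by
  obtain ⟨𝔓', h𝔓'max, hsup⟩ := hram
  haveI := h𝔓'max
  haveI hKn : ∀ m, Normal k (κ.layer m) := fun m => inferInstance
  refine equivariantHom_classGroup_eq_zero_compositum_tower (hKab := fun m => κ.isAbelianGalois_layer m)
    p hp2 L₀ hL₀ κ.layer (fun m => κ.layer_mono (Nat.le_succ m)) κ.layer_zero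
    (fun m => κ.finrank_layer_holds m) hpV hV h0 ?_ ?_ n f hf
  · -- (c3*)ₙ from (c3*-I): the ramified prime contains `p`
    intro m 𝔓 _ hex w hw
    obtain ⟨σ, hI, -, -, hne⟩ := hex
    exact eq_zero_of_forall_stabilizer_smul_of_inertia L₀
      (L₀ ⊔ κ.layer (m + 1) : IntermediateField k (AlgebraicClosure k)) 𝔓
      (natCast_mem_of_mem_inertia_of_absRestrictNormalHom_layer_ne_one κ (m + 1)
        (L₀ ⊔ κ.layer (m + 1) : IntermediateField k (AlgebraicClosure k)) le_sup_right 𝔓 hI hne)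
      hV hDI w hw
  · -- the ramified prime with few conjugates, from `𝔓̄`
    intro m
    obtain ⟨σ, hσI, h0σ, hn, hn1, hidx⟩ := exists_orbit_input_of_totallyRamified κ L₀ hL₀ hsup m
    haveI : (𝔓'.comap (ringOfIntegersToIntegralClosure (k := k) (Ω := AlgebraicClosure k)
        (L₀ ⊔ κ.layer (m + 1) : IntermediateField k (AlgebraicClosure k)))).IsMaximal :=
      @Ideal.isMaximal_comap_of_isIntegral_of_isMaximal' _ _ _ _ _
        (isIntegral_ringOfIntegersToIntegralClosure' _) 𝔓' h𝔓'max
    refine ⟨_, this, ⟨σ, ?_, h0σ, ?_, ?_⟩, hidx⟩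
    · rw [inertia_comap_ringOfIntegers_eq_map_absRestrictNormalHom
        (L₀ ⊔ κ.layer (m + 1) : IntermediateField k (AlgebraicClosure k)) 𝔓']
      exact Subgroup.mem_map_of_mem _ hσI
    · exact (absRestrictNormalHom_layer_eq_one_iff₃ κ m σ).mpr hn
    · exact fun h => hn1 ((absRestrictNormalHom_layer_eq_one_iff₃ κ (m + 1) σ).mp h)

end Inertia

end EquivariantIwasawaLemma

end Literature.NumberTheory.NumberFields

end
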